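import Summits.BirchSwinnertonDyer.BirchSwinnertonDyer.Theorems.PrintCf2SplitBadTwoRestrictedControlOfF3H2
import Summits.BirchSwinnertonDyer.BirchSwinnertonDyer.Theorems.PrintCf2SplitBadTwoH2Holds
import Summits.BirchSwinnertonDyer.BirchSwinnertonDyer.Theorems.PrintCf2SplitBadTwoF3OfLevelCounts
import HarnessLib

/-!
# Crux `PrintCf2.SplitBadTwoRankOneOfFacts` (stmt-BirchSwinnertonDyer-20368), road α v10.3 — S3c assembly, SIXTEENTH CUT:
# (H2) DISCHARGED — `stub_restrictedControl_two` ⟸ (F3) ALONE, and ⟸ the level-`N` index count `hcounts` ALONE (fact-free)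

Cell `bsd-print-cf2`, LEAD seat `bsd-line-cf2-p1` g13 (prover-bsd-line-cf2-p1-g13-0); `--supports stmt-BirchSwinnertonDyer-20368` (helper, Theses-free).
HONEST FRAMING: proves the registered statement of S3c from ONE displayed hypothesis — (F3) (first theorem) or -w5 g3's level-`N` index count
`hcounts` (second theorem); every other input is a tree THEOREM (no named-fact hypothesis). BSD is not proved by any of this; no summit statement
is proved by this seat. No definition, no `sorry`.

WHAT CHANGED AGAINST CUT 15 (`restrictedControl_two_of_F3_H2`, fact-free, (F1) := `hF1_holds`). (H2) `loc_v̄(𝔖_v ⊓ L_M) ⊆ loc_v̄(Q_M)` is a THEOREM on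
every frame: -w2 g11's `CMPrimes.hH2_holds` (p678559; -w7 g3's recipe: the rank-one local Kummer line at `v̄` p672775 + the CM projector + p672215).
So **S3c ⟸ (F3)** `v₂ #loc_v(𝔖_{v̄}(K,W*)) = ℓ + e₃([d]₂)` — and, composing with -w5 g3's `hF3_of_levelCounts` (p678471, the (P1) level lift p677230/
p678012), **S3c ⟸ hcounts**: for every CM projector `e` and all large `N`, some level shadow `eN` with `ι_N ∘ eN = e ∘ ι_N`, every OPTION A‴ torsion
structure `𝓕` on `E[2^N]` (`⊤` at ∞, unramified-Kummer `N^E_w` off `v`, `(N^E_v).comap H¹(eN|K_v)` at `v`):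
`v₂ [H¹_{𝓕[v ↦ ⊤]}(K, E[2^N]) : H¹_𝓕(K, E[2^N])] = ℓ + e₃(d % 2, (d/(2 − d % 2)) % 8)`. THIS is the one displayed statement the (F3) seats now
target (-w2 g11's split 23:38:20Z: (LF.1) `#E(K_v)[2^N]`, (LF.2) `#(N^E_v ⊓ range H¹(ẽ_N|K_v)) = #W*(K_v)`, (LF.3) `#(𝓞_v/2^N) = 2^N`, (T4) the dual
image count, (ASM) via -w4 g9's master identity p678152; owners -w2 g11 / -w4 g10 / -w8 g3 / -w3 g10). Expected `e₃ ≡ 0` (LEAD g12 F3-PT-ANALYSIS).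
DISCHARGE AGAINST THIS CUT; when `hcounts` (or (F3)) lands, `stub_restrictedControl_two` closes VERBATIM and fact-free.
presearch: not applicable (assembly of tree theorems). beyond-print theorem: no.

References: [Agboola2007] §3 Prop. 3.2, §5, §6 Prop. 6.10–6.11, Prop. 8.1; [GreenbergLNM1716] §3 Lemmas 3.1–3.3, §4 Lemma 4.2, §5 Prop. 5.8;
[MilneADT2006] I Thm. 4.10; [MazurRubin2004] Def. 2.1.1.
-/

noncomputable section

open scoped Classical

set_option linter.dupNamespace false
set_option autoImplicit false

open NumberField IsDedekindDomain Field WeierstrassCurve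
open Literature.NumberTheory.EllipticCurves Literature.NumberTheory.EllipticCurves.GreenbergSelmer
open Literature.NumberTheory.EllipticCurves.Agboola2007
open Literature.NumberTheory.EllipticCurves.IwasawaAlgebra
open Literature.NumberTheory.EllipticCurves.IwasawaDual
open Literature.NumberTheory.EllipticCurves.ResKernel
open Literature.NumberTheory.GaloisRepresentations
open Literature.NumberTheory.GaloisRepresentations.DiscreteGaloisModule (SelmerStructure)
open Literature.NumberTheory.GaloisCohomology
open Literature.NumberTheory.EllipticCurves.Castella2018.AcSelmer
open scoped ContRepresentation
open Summit.BirchSwinnertonDyer.Rank1Residual.X11b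
open Summit.BirchSwinnertonDyer.Rank1Residual.X11b.Levels
open Summit.BirchSwinnertonDyer.BirchSwinnertonDyer.Theorems.PrintCf2.AdditiveAtSeven
open Summit.BirchSwinnertonDyer.BirchSwinnertonDyer.Theorems.GoldfeldGoodTwists

namespace Summit.BirchSwinnertonDyer.BirchSwinnertonDyer.Theorems.PrintCf2.RestrictedSelmerPair

/-- **S3c `stub_restrictedControl_two` — SIXTEENTH CUT (a): ⟸ (F3) alone, fact-free**: cut 15 with `hH2 := CMPrimes.hH2_holds` (-w2 g11, p678559).
[cite: Agboola2007, §3 Prop. 3.2, §6 Prop. 6.10–6.11, §8 Prop. 8.1] [cite: GreenbergLNM1716, §3 Lemmas 3.1–3.3, §4 Lemma 4.2] [cite: MilneADT2006, I Thm. 4.10] -/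
theorem restrictedControl_two_of_F3
    (hF3 : ∃ e₃ : ℤ → ℤ → ℤ, ∀ (d : ℤ), d ≠ 0 → Squarefree d → d % 4 ≠ 1 →
      ∀ (W : WeierstrassCurve ℚ) [W.IsElliptic] [W.IsGloballyMinimal] (C : WeierstrassCurve.VariableChange ℚ),
        C • W = cm7.quadraticTwist (d : ℚ) → W.analyticRank = 1 →
      ∀ (K : Type) [Field K] [NumberField K], IsImaginaryQuadratic K →
      ∀ (v vbar : HeightOneSpectrum (𝓞 K)),
        ((2 : ℕ) : 𝓞 K) ∈ v.asIdeal → ((2 : ℕ) : 𝓞 K) ∈ vbar.asIdeal → vbar ≠ v →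
      ∀ (π : (W.baseChange K).endRing), (π : AddMonoid.End (W.baseChange K).geomPoints) * π = π - 2 →
      ∀ (r : ℤ_[2]), r * r = r - 2 →
        (∀ τ ∈ GreenbergSelmer.inertia v, ∀ x : ↥((W.baseChange K).endEigenPrimaryTorsion 2 π r), τ • x = x ∨ τ • x = -x) →
      ∀ (P : W.toAffine.Point) (c₀ : ℕ) (ℓ : ℤ),
        ¬ IsOfFinAddOrder P →
        (∀ R : W.toAffine.Point, ∃ (k : ℤ) (T : W.toAffine.Point), IsOfFinAddOrder T ∧ R = k • P + T) →
        c₀ ≠ 0 → (W.baseChange ℚ_[2]).IsInReductionKernel (c₀ • W.toPadicPoint 2 P) →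
        ‖(W.baseChange ℚ_[2]).padicLogPoint (c₀ • W.toPadicPoint 2 P) / (c₀ : ℚ_[2])‖ = (2 : ℝ) ^ (-ℓ) →
      Finite (restrictedSelmerBase ↥((W.baseChange K).endEigenPrimaryTorsion 2 π r) 2 vbar) →
        (padicValNat 2 (Nat.card ((resOfLe ↥((W.baseChange K).endEigenPrimaryTorsion 2 π r) (inf_le_left : ⊤ ⊓ decomp v ≤ ⊤)).comp
          (restrictedSelmerBase ↥((W.baseChange K).endEigenPrimaryTorsion 2 π r) 2 vbar).subtype).range) : ℤ) = ℓ + e₃ (d % 2) ((d / (2 - d % 2)) % 8)) :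
    -- CONCLUSION: S3c `stub_restrictedControl_two`, v9 = v10.3 VERBATIM
    ∃ eC : ℤ → ℤ → ℤ,
    ∀ (d : ℤ), d ≠ 0 → Squarefree d → d % 4 ≠ 1 →
    ∀ (W : WeierstrassCurve ℚ) [W.IsElliptic] [W.IsGloballyMinimal] (C : VariableChange ℚ),
      C • W = cm7.quadraticTwist (d : ℚ) → W.analyticRank = 1 →
    ∀ (K : Type) [Field K] [NumberField K], IsImaginaryQuadratic K →
    ∀ (v vbar : HeightOneSpectrum (𝓞 K)),
      ((2 : ℕ) : 𝓞 K) ∈ v.asIdeal → ((2 : ℕ) : 𝓞 K) ∈ vbar.asIdeal → vbar ≠ v →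
    ∀ (π : (W.baseChange K).endRing), (π : AddMonoid.End (W.baseChange K).geomPoints) * π = π - 2 →
    ∀ (r : ℤ_[2]), r * r = r - 2 →
      (∀ τ ∈ GreenbergSelmer.inertia v, ∀ x : ↥((W.baseChange K).endEigenPrimaryTorsion 2 π r), τ • x = x ∨ τ • x = -x) →
    ∀ (κ' : ZpExtension K 2), κ'.IsUnramifiedOutside vbar → ∀ (γ' : absoluteGaloisGroup K), κ'.IsTopGenerator γ' →
    ∀ (D : Agboola2007.RestrictedDualData κ' ↥((W.baseChange K).endEigenPrimaryTorsion 2 π r) vbar γ') (n : ℕ),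
      Module.Finite (IwasawaAlgebra 2) D.X → D.HasCharValuationAt n →
    ∀ (P : W.toAffine.Point) (c₀ : ℕ) (ℓ : ℤ),
      ¬ IsOfFinAddOrder P →
      (∀ R : W.toAffine.Point, ∃ (k : ℤ) (T : W.toAffine.Point), IsOfFinAddOrder T ∧ R = k • P + T) →
      c₀ ≠ 0 → (W.baseChange ℚ_[2]).IsInReductionKernel (c₀ • W.toPadicPoint 2 P) →
      ‖(W.baseChange ℚ_[2]).padicLogPoint (c₀ • W.toPadicPoint 2 P) / (c₀ : ℚ_[2])‖ = (2 : ℝ) ^ (-ℓ) →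
      (n : ℤ) = ((padicValNat 2 (Nat.card (AddCommGroup.primaryComponent W.sha 2)) : ℤ)
            + (padicValNat 2 W.tamagawaProduct : ℤ)
            - 2 * (padicValNat 2 W.torsionOrder : ℤ) + 2 * ℓ) + eC (d % 2) ((d / (2 - d % 2)) % 8) := by
  haveI : Fact (Nat.Prime 2) := ⟨Nat.prime_two⟩
  exact restrictedControl_two_of_F3_H2 hF3 CMPrimes.hH2_holds

/-- **S3c `stub_restrictedControl_two` — SIXTEENTH CUT (b): ⟸ the level-`N` index count `hcounts` alone, fact-free**: (a) composed with
-w5 g3's `hF3_of_levelCounts` (p678471). `hcounts` VERBATIM from that theorem.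
[cite: GreenbergLNM1716, §5 proof of Prop. 5.8] [cite: Agboola2007, §6 Prop. 6.10–6.11] [cite: MazurRubin2004, Def. 2.1.1] -/
theorem restrictedControl_two_of_levelCounts
    (hcounts : ∃ e₃ : ℤ → ℤ → ℤ, ∀ (d : ℤ), d ≠ 0 → Squarefree d → d % 4 ≠ 1 →
      ∀ (W : WeierstrassCurve ℚ) [W.IsElliptic] [W.IsGloballyMinimal] (C : WeierstrassCurve.VariableChange ℚ),
        C • W = cm7.quadraticTwist (d : ℚ) → W.analyticRank = 1 →
      ∀ (K : Type) [Field K] [NumberField K], IsImaginaryQuadratic K →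
      ∀ (v vbar : HeightOneSpectrum (𝓞 K)),
        ((2 : ℕ) : 𝓞 K) ∈ v.asIdeal → ((2 : ℕ) : 𝓞 K) ∈ vbar.asIdeal → vbar ≠ v →
      ∀ (π : (W.baseChange K).endRing), (π : AddMonoid.End (W.baseChange K).geomPoints) * π = π - 2 →
      ∀ (r : ℤ_[2]), r * r = r - 2 →
        (∀ τ ∈ GreenbergSelmer.inertia v, ∀ x : ↥((W.baseChange K).endEigenPrimaryTorsion 2 π r), τ • x = x ∨ τ • x = -x) →
      ∀ (P : W.toAffine.Point) (c₀ : ℕ) (ℓ : ℤ),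
        ¬ IsOfFinAddOrder P →
        (∀ R : W.toAffine.Point, ∃ (k : ℤ) (T : W.toAffine.Point), IsOfFinAddOrder T ∧ R = k • P + T) →
        c₀ ≠ 0 → (W.baseChange ℚ_[2]).IsInReductionKernel (c₀ • W.toPadicPoint 2 P) →
        ‖(W.baseChange ℚ_[2]).padicLogPoint (c₀ • W.toPadicPoint 2 P) / (c₀ : ℚ_[2])‖ = (2 : ℝ) ^ (-ℓ) →
      Finite (restrictedSelmerBase ↥((W.baseChange K).endEigenPrimaryTorsion 2 π r) 2 vbar) →
      ∀ (e : (W.baseChange K).geomPrimaryTorsion 2 →+ ↥((W.baseChange K).endEigenPrimaryTorsion 2 π r)),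
        (∀ x : ↥((W.baseChange K).endEigenPrimaryTorsion 2 π r), e x = x) →
        (∀ x ∈ (W.baseChange K).endEigenPrimaryTorsion 2 π (1 - r), e x = 0) →
        (∀ (σ : absoluteGaloisGroup K) (x : (W.baseChange K).geomPrimaryTorsion 2), e (σ • x) = σ • e x) →
      ∃ N₁ : ℕ, ∀ N : ℕ, N₁ ≤ N →
        ∃ eN : ((W.baseChange K).torsionGaloisModule ((2 ^ N : ℕ) : ℤ)).toContRepresentation →ⁱL
            ((W.baseChange K).torsionGaloisModule ((2 ^ N : ℕ) : ℤ)).toContRepresentation,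
          (∀ y, primaryInclusion (W.baseChange K) 2 N (eN y) =
            (e (primaryInclusion (W.baseChange K) 2 N y) : (W.baseChange K).geomPrimaryTorsion 2)) ∧
          ∀ 𝓕 : SelmerStructure ((W.baseChange K).torsionGaloisModule ((2 ^ N : ℕ) : ℤ)),
            (∀ w : InfinitePlace K, 𝓕 (Sum.inl w) = ⊤) →
            (∀ w : HeightOneSpectrum (𝓞 K), w ≠ v →
              𝓕 (Sum.inr w) = (galoisCohomology.map ((primaryInclusion (W.baseChange K) 2 N).restrictField (w.adicCompletion K)) 1).ker) →
            𝓕 (Sum.inr v) = ((galoisCohomology.map ((primaryInclusion (W.baseChange K) 2 N).restrictField (v.adicCompletion K)) 1).ker).comap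
              (galoisCohomology.map (eN.restrictField (v.adicCompletion K)) 1) →
            (padicValNat 2 (𝓕.selmerGroup.relIndex (SelmerStructure.selmerGroup (Function.update 𝓕 (Sum.inr v : Place K) ⊤))) : ℤ) =
              ℓ + e₃ (d % 2) ((d / (2 - d % 2)) % 8)) :
    -- CONCLUSION: S3c `stub_restrictedControl_two`, v9 = v10.3 VERBATIM
    ∃ eC : ℤ → ℤ → ℤ,
    ∀ (d : ℤ), d ≠ 0 → Squarefree d → d % 4 ≠ 1 →
    ∀ (W : WeierstrassCurve ℚ) [W.IsElliptic] [W.IsGloballyMinimal] (C : VariableChange ℚ),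
      C • W = cm7.quadraticTwist (d : ℚ) → W.analyticRank = 1 →
    ∀ (K : Type) [Field K] [NumberField K], IsImaginaryQuadratic K →
    ∀ (v vbar : HeightOneSpectrum (𝓞 K)),
      ((2 : ℕ) : 𝓞 K) ∈ v.asIdeal → ((2 : ℕ) : 𝓞 K) ∈ vbar.asIdeal → vbar ≠ v →
    ∀ (π : (W.baseChange K).endRing), (π : AddMonoid.End (W.baseChange K).geomPoints) * π = π - 2 →
    ∀ (r : ℤ_[2]), r * r = r - 2 →
      (∀ τ ∈ GreenbergSelmer.inertia v, ∀ x : ↥((W.baseChange K).endEigenPrimaryTorsion 2 π r), τ • x = x ∨ τ • x = -x) →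
    ∀ (κ' : ZpExtension K 2), κ'.IsUnramifiedOutside vbar → ∀ (γ' : absoluteGaloisGroup K), κ'.IsTopGenerator γ' →
    ∀ (D : Agboola2007.RestrictedDualData κ' ↥((W.baseChange K).endEigenPrimaryTorsion 2 π r) vbar γ') (n : ℕ),
      Module.Finite (IwasawaAlgebra 2) D.X → D.HasCharValuationAt n →
    ∀ (P : W.toAffine.Point) (c₀ : ℕ) (ℓ : ℤ),
      ¬ IsOfFinAddOrder P →
      (∀ R : W.toAffine.Point, ∃ (k : ℤ) (T : W.toAffine.Point), IsOfFinAddOrder T ∧ R = k • P + T) →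
      c₀ ≠ 0 → (W.baseChange ℚ_[2]).IsInReductionKernel (c₀ • W.toPadicPoint 2 P) →
      ‖(W.baseChange ℚ_[2]).padicLogPoint (c₀ • W.toPadicPoint 2 P) / (c₀ : ℚ_[2])‖ = (2 : ℝ) ^ (-ℓ) →
      (n : ℤ) = ((padicValNat 2 (Nat.card (AddCommGroup.primaryComponent W.sha 2)) : ℤ)
            + (padicValNat 2 W.tamagawaProduct : ℤ)
            - 2 * (padicValNat 2 W.torsionOrder : ℤ) + 2 * ℓ) + eC (d % 2) ((d / (2 - d % 2)) % 8) := by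
  haveI : Fact (Nat.Prime 2) := ⟨Nat.prime_two⟩
  exact restrictedControl_two_of_F3 (hF3_of_levelCounts hcounts)

end Summit.BirchSwinnertonDyer.BirchSwinnertonDyer.Theorems.PrintCf2.RestrictedSelmerPair

end
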